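import Literature.Algebra.Polynomial.PolyaPositivstellensatz
import Literature.Analysis.Convex.LinearProgrammingDuality

/-!
# Handelman's theorem for compact polytopes, and the Minkowski normalisation

Let `β_j = c_j + ∑_i a_{j i} x_i` (`j ∈ J`) be finitely many linear ("affine") polynomials in the
real variables `x_i` (`i ∈ ι`, `ι` finite and non-empty), and let
`K = {x | β_j(x) ≥ 0 for all j} ⊆ ℝ^ι` be the convex polyhedron they define. Throughout, as in
[cite: Handelman1988, Thm I.3], `K` is assumed *compact with non-empty interior*.

* `handelman_polytope_degree`, `handelman_polytope` — **Handelman's theorem**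
  [cite: Handelman1988, Thm I.3] [cite: Scheiderer2008, Thm 2.2.5] [cite: PowersReznick2001, §1]:
  if a real polynomial `p` is strictly positive on `K`, then `p` is a linear combination with
  strictly positive coefficients of products `∏_j β_j^{w(j)}` of the `β_j` ("monomials in the
  `β_j`"); `_degree` is the sharp form that Pólya's theorem yields (Powers–Reznick): for every
  sufficiently large `D`, one may use exactly the products of total degree `|w| = D`, *all* with
  strictly positive coefficients.
* `exists_pos_sum_smul_affineForm_eq_one` — the **Minkowski normalisation**
  [cite: Handelman1988, Cor I.2] (with [cite: Handelman1988, Prop I.1(c)]): the constant `1` is a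
  combination `∑_j μ_j β_j` with all `μ_j > 0`, and every coordinate `x_i` is a linear combination
  of the `β_j`. Hence the rescaled generators `f_j = μ_j β_j` satisfy `∑ f_j = 1` and generate
  `ℝ[x]`, which is the presentation in which `handelman_of_sum_eq_one`
  (`Literature/Algebra/Polynomial/PolyaPositivstellensatz.lean`, after Scheiderer 2.2.2 / Pólya)
  proves the theorem; `handelman_of_pos_sum_smul_affineForm_eq_one` is the resulting
  *certificate form* of Handelman's theorem (hypotheses: the multipliers `μ` and the coordinate
  representations, no topology), from which the geometric statements follow.
  Our proof of the normalisation is not Handelman's polarity argument but the LP route: a compact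
  non-empty `K` has no non-zero recession direction (`eq_zero_of_forall_dotProduct_nonneg`:
  `a_j ⬝ y ≥ 0` for all `j` forces `y = 0`), so Stiemke's transposition theorem
  [cite: Schrijver1986, §7.8 (32) (p. 95)]
  (`Literature.Analysis.Convex.LPDuality.stiemke_transposition`) gives `μ > 0` with
  `∑ μ_j a_j = 0`; the constant `∑ μ_j c_j` is then `> 0` because `K` has an
  interior point, and the `a_j` span all linear forms because they have no common kernel vector.
* `eval_nonneg_of_eq_sum_prod_affineForm` — the (trivial) converse: such a representation with
  coefficients `≥ 0` certifies `p ≥ 0` on `K` [cite: Handelman1988, §I (remark before I.1)].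
* `exists_nonneg_sum_smul_eq_of_nonneg`, `exists_pos_sum_smul_eq_of_pos`,
  `affineForm_eq_sum_C_mul_affineForm` — [cite: Handelman1988, Prop I.1(a)]
  [cite: Handelman1988, Prop I.1(b)] (Minkowski; the affine Farkas lemma on a compact polytope with
  interior): an *affine* function `d + u ⬝ x` that is `≥ 0` (resp. `> 0`) on `K` is a combination
  `∑_j ν_j β_j` with all `ν_j ≥ 0` (resp. `> 0`) — as an identity of affine functions, constants
  included: the degree-one case of the theorem, and it is exact. Via the tree's affine form of
  Farkas' lemma [cite: Schrijver1986, Cor 7.1h (p. 93)]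
  (`Literature.Analysis.Convex.LPDuality.affine_farkas`) plus the normalisation, which absorbs the
  constant slack.
* `eval_eq_zero_of_eq_sum_prod_affineForm`, `coeff_repr_eq_zero_of_eval_eq_zero` — Handelman's
  necessary condition [cite: Handelman1988, §III (necessary condition)]: the zero set in `K` of a
  polynomial with such a representation is a union of faces (a representation vanishing at `x₀`
  vanishes wherever the linear forms active at `x₀` vanish; one vanishing at a point with all
  `β_j > 0` is identically zero) — so an LP (Handelman) certificate of `p ≥ 0` is never tight at
  a relative-interior point of a face on which `p` does not vanish identically.

Not formalised here: coefficient subfields `L ⊆ ℝ` (Handelman states I.1–I.3 over any subfield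
`L`, the representation then having coefficients in `L ∩ ℝ₊`); the Powers–Reznick degree bound for
polytopes; Handelman's §III examples `f_N` (a sum of squares vanishing only at a vertex of `K`
yet not in the cone, for every `K` of dimension `> 1`).

## References

* D. Handelman, *Representing polynomials by positive linear functions on compact convex
  polyhedra*, Pacific J. Math. 132 (1988), no. 1, 35–62: Proposition I.1, Corollary I.2,
  Theorem I.3 [cite: Handelman1988, Thm I.3].
* C. Scheiderer, *Positivity and sums of squares: a guide to recent results*, in: Emerging
  Applications of Algebraic Geometry, IMA Vol. Math. Appl. 149, Springer (2009), 271–324,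
  Theorem 2.2.5 and the remark following it [cite: Scheiderer2008, Thm 2.2.5].
* V. Powers, B. Reznick, *A new bound for Pólya's Theorem with applications to polynomials
  positive on polyhedra*, J. Pure Appl. Algebra 164 (2001), 221–229, §1
  [cite: PowersReznick2001, §1].
* A. Schrijver, *Theory of Linear and Integer Programming*, Wiley (1986), §7.8 (32) (Stiemke's
  transposition theorem) [cite: Schrijver1986, §7.8 (32) (p. 95)].
-/

noncomputable section

open MvPolynomial Finset Matrix
open scoped BigOperators

namespace Literature.Algebra.Polynomial

section AffineForm

variable {ι : Type*} [Fintype ι]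

/-- The affine ("linear") polynomial `c + ∑_i a_i x_i ∈ ℝ[x]` with constant term `c` and linear
part `a` — Handelman's "linear form" `β = ∑_j a_j x_j + a_{d+1}` [cite: Handelman1988, Thm I.3]. -/
def affineForm (a : ι → ℝ) (c : ℝ) : MvPolynomial ι ℝ := C c + ∑ i, C (a i) * X i

/-- Evaluation of a linear form: `β(x) = c + a ⬝ x` [cite: Handelman1988, Thm I.3]. -/
@[simp] theorem eval_affineForm (a : ι → ℝ) (c : ℝ) (x : ι → ℝ) :
    eval x (affineForm a c) = c + a ⬝ᵥ x := by
  simp [affineForm, dotProduct, map_sum]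

/-- Linear combinations of linear forms are computed coefficientwise. [folklore] -/
private theorem sum_C_mul_affineForm {J : Type*} [Fintype J] (w : J → ℝ) (a : J → ι → ℝ)
    (c : J → ℝ) :
    ∑ j, C (w j) * affineForm (a j) (c j) = affineForm (∑ j, w j • a j) (∑ j, w j * c j) := by
  classical
  simp only [affineForm, Finset.sum_apply, Pi.smul_apply, smul_eq_mul, mul_add, Finset.mul_sum,
    ← mul_assoc, ← C_mul, map_sum, Finset.sum_add_distrib, Finset.sum_mul]
  congr 1
  exact Finset.sum_comm

/-- The linear form with linear part the `i`-th coordinate vector is `c + x_i`. [folklore] -/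
private theorem affineForm_single [DecidableEq ι] (i : ι) (c : ℝ) :
    affineForm (Pi.single i 1) c = C c + X i := by
  simp only [affineForm, Pi.single_apply]
  congr 1
  rw [Finset.sum_eq_single i (fun j _ hj => by simp [hj]) (fun h => absurd (mem_univ i) h)]
  simp

end AffineForm

section Certificate

variable {ι J : Type*} [Fintype ι] [Fintype J]

/-- **Handelman's theorem, certificate form (by degree)** [cite: Handelman1988, Thm I.3]
[cite: Handelman1988, Cor I.2] [cite: Scheiderer2008, Thm 2.2.5] [cite: PowersReznick2001, §1].
Let `β_j = c_j + a_j ⬝ x` (`j ∈ J`) be linear polynomials such that `∑_j μ_j β_j = 1` for some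
reals `μ_j > 0` (equivalently `∑ μ_j a_j = 0` and `∑ μ_j c_j = 1`; this is Handelman's Cor I.2 —
such `μ` exist whenever `K = {β_j ≥ 0}` is compact with non-empty interior, see
`exists_pos_sum_smul_affineForm_eq_one`) and such that every coordinate vector `e_i` is a linear
combination `∑_j γ_j a_j` of the linear parts (Handelman's Prop I.1(c)). If a real polynomial `p`
is strictly positive on `K`, then for every sufficiently large `D`,
`p = ∑_{|w| = D} r_w ∏_j β_j^{w(j)}` with *all* `r_w > 0`.
(From `handelman_of_sum_eq_one` applied to the generators `f_j = μ_j β_j`, which sum to `1` and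
generate `ℝ[x]`.) -/
theorem handelman_of_pos_sum_smul_affineForm_eq_one [DecidableEq ι] [DecidableEq J]
    (a : J → ι → ℝ) (c : J → ℝ) (μ : J → ℝ) (hμ : ∀ j, 0 < μ j) (hμa : ∑ j, μ j • a j = 0)
    (hμc : ∑ j, μ j * c j = 1)
    (hspan : ∀ i, ∃ γ : J → ℝ, ∑ j, γ j • a j = Pi.single i 1)
    (p : MvPolynomial ι ℝ) (hpos : ∀ x : ι → ℝ, (∀ j, 0 ≤ c j + a j ⬝ᵥ x) → 0 < eval x p) :
    ∃ D₀ : ℕ, ∀ D : ℕ, D₀ ≤ D → ∃ r : (J →₀ ℕ) → ℝ, (∀ w : J →₀ ℕ, w.degree = D → 0 < r w) ∧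
      p = ∑ w ∈ (univ : Finset J).finsuppAntidiag D,
        C (r w) * ∏ j, affineForm (a j) (c j) ^ w j := by
  classical
  -- the generators `f_j = μ_j β_j` sum to one
  set f : J → MvPolynomial ι ℝ := fun j => C (μ j) * affineForm (a j) (c j) with hf
  have hsum : ∑ j, f j = 1 := by
    simp only [hf]
    rw [sum_C_mul_affineForm, hμa, hμc]
    simp [affineForm]
  -- every `x_i` is a polynomial (indeed a linear combination) in the `f_j`
  choose γ hγ using hspan
  set g : ι → MvPolynomial J ℝ :=
    fun i => (∑ j, C (γ i j * (μ j)⁻¹) * X j) - C (∑ j, γ i j * c j) with hg_def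
  have hg : ∀ i, aeval f (g i) = X i := fun i => by
    have h1 : ∀ j, aeval f (C (γ i j * (μ j)⁻¹) * X j) = C (γ i j) * affineForm (a j) (c j) :=
      fun j => by
        rw [map_mul, aeval_C, algebraMap_eq, aeval_X, hf]
        dsimp only
        rw [← mul_assoc, ← C_mul, mul_assoc, inv_mul_cancel₀ (hμ j).ne', mul_one]
    rw [hg_def]
    dsimp only
    rw [map_sub, map_sum, aeval_C, algebraMap_eq]
    simp_rw [h1]
    rw [sum_C_mul_affineForm, hγ i, affineForm_single]
    ring
  -- positivity on `K = {f_j ≥ 0} = {β_j ≥ 0}`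
  have hpos' : ∀ x : ι → ℝ, (∀ j, 0 ≤ eval x (f j)) → 0 < eval x p := fun x hx => by
    refine hpos x fun j => ?_
    have h := hx j
    rw [hf] at h
    dsimp only at h
    rw [map_mul, eval_C, eval_affineForm] at h
    exact (mul_nonneg_iff_of_pos_left (hμ j)).mp h
  obtain ⟨D₀, hD₀⟩ := handelman_of_sum_eq_one f hsum g hg p hpos'
  refine ⟨D₀, fun D hD => ?_⟩
  obtain ⟨r, hr, hp⟩ := hD₀ D hD
  refine ⟨fun w => r w * ∏ j, μ j ^ w j,
    fun w hw => mul_pos (hr w hw) (prod_pos fun j _ => pow_pos (hμ j) _),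
    hp.trans (sum_congr rfl fun w _ => ?_)⟩
  simp only [hf, mul_pow, prod_mul_distrib, ← C_pow, ← map_prod C, C_mul]
  ring

/-- **Soundness of Handelman representations** (the trivial converse)
[cite: Handelman1988, §I (remark before I.1)]: a combination with coefficients `≥ 0` of products
of the `β_j` is `≥ 0` wherever all `β_j ≥ 0`. -/
theorem eval_nonneg_of_eq_sum_prod_affineForm (a : J → ι → ℝ) (c : J → ℝ)
    (s : Finset (J →₀ ℕ)) (r : (J →₀ ℕ) → ℝ) (hr : ∀ w ∈ s, 0 ≤ r w) (p : MvPolynomial ι ℝ)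
    (hp : p = ∑ w ∈ s, C (r w) * ∏ j, affineForm (a j) (c j) ^ w j)
    (x : ι → ℝ) (hx : ∀ j, 0 ≤ c j + a j ⬝ᵥ x) : 0 ≤ eval x p := by
  rw [hp, map_sum]
  refine sum_nonneg fun w hw => ?_
  rw [map_mul, eval_C, map_prod]
  refine mul_nonneg (hr w hw) (prod_nonneg fun j _ => ?_)
  rw [map_pow, eval_affineForm]
  exact pow_nonneg (hx j) _

end Certificate

section Minkowski

variable {ι J : Type*} [Fintype ι] [Fintype J]

omit [Fintype J] in
/-- A non-empty compact polyhedron `K = {x | c_j + a_j ⬝ x ≥ 0 ∀ j}` has no non-zero recession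
direction: if `a_j ⬝ y ≥ 0` for all `j`, then `y = 0` (else the ray `x₀ + t y`, `t ≥ 0`, from a
point `x₀ ∈ K` stays in `K`, along which `x ↦ y ⬝ x` is unbounded).
[cite: Schrijver1986, §7.8 (32) (p. 95)] [cite: Handelman1988, Prop I.1] -/
theorem eq_zero_of_forall_dotProduct_nonneg (a : J → ι → ℝ) (c : J → ℝ)
    (hK : IsCompact {x : ι → ℝ | ∀ j, 0 ≤ c j + a j ⬝ᵥ x}) {x₀ : ι → ℝ}
    (hx₀ : x₀ ∈ {x : ι → ℝ | ∀ j, 0 ≤ c j + a j ⬝ᵥ x}) {y : ι → ℝ} (hy : ∀ j, 0 ≤ a j ⬝ᵥ y) :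
    y = 0 := by
  by_contra hy0
  have hyy : 0 < y ⬝ᵥ y := by
    refine lt_of_le_of_ne (Finset.sum_nonneg fun i _ => mul_self_nonneg (y i)) ?_
    exact fun h => hy0 (dotProduct_self_eq_zero.mp h.symm)
  -- `x ↦ y ⬝ x` attains its maximum `M` on the compact set `K`
  have hcont : Continuous fun x : ι → ℝ => y ⬝ᵥ x := continuous_const.dotProduct continuous_id
  obtain ⟨x₁, -, hx₁⟩ := hK.exists_isMaxOn ⟨x₀, hx₀⟩ hcont.continuousOn
  -- but the ray `x₀ + t y` lies in `K`
  set t : ℝ := (|y ⬝ᵥ x₁ - y ⬝ᵥ x₀| + 1) / (y ⬝ᵥ y) with ht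
  have ht0 : 0 ≤ t := div_nonneg (by positivity) hyy.le
  have hmem : x₀ + t • y ∈ {x : ι → ℝ | ∀ j, 0 ≤ c j + a j ⬝ᵥ x} := fun j => by
    rw [dotProduct_add, dotProduct_smul, smul_eq_mul, ← add_assoc]
    exact add_nonneg (hx₀ j) (mul_nonneg ht0 (hy j))
  have hle : y ⬝ᵥ (x₀ + t • y) ≤ y ⬝ᵥ x₁ := hx₁ hmem
  rw [dotProduct_add, dotProduct_smul, smul_eq_mul, ht, div_mul_cancel₀ _ hyy.ne'] at hle
  have habs := le_abs_self (y ⬝ᵥ x₁ - y ⬝ᵥ x₀)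
  linarith

/-- From the absence of recession directions, **Stiemke's transposition theorem**
[cite: Schrijver1986, §7.8 (32) (p. 95)] produces strictly positive multipliers `μ_j > 0` with
`∑_j μ_j a_j = 0` [cite: Handelman1988, Cor I.2]. -/
theorem exists_pos_sum_smul_eq_zero (a : J → ι → ℝ) (c : J → ℝ)
    (hK : IsCompact {x : ι → ℝ | ∀ j, 0 ≤ c j + a j ⬝ᵥ x})
    (hne : {x : ι → ℝ | ∀ j, 0 ≤ c j + a j ⬝ᵥ x}.Nonempty) :
    ∃ μ : J → ℝ, (∀ j, 0 < μ j) ∧ ∑ j, μ j • a j = 0 := by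
  classical
  obtain ⟨x₀, hx₀⟩ := hne
  -- the matrix with columns `a_j`
  set A : Matrix ι J ℝ := Matrix.of fun i j => a j i with hA
  have hvec : ∀ (y : ι → ℝ) (j : J), (y ᵥ* A) j = a j ⬝ᵥ y := fun y j => by
    rw [dotProduct_comm]; rfl
  obtain ⟨μ, hμ, hAμ⟩ := (Literature.Analysis.Convex.LPDuality.stiemke_transposition A).mpr
    fun y hy => by
      have hy' : ∀ j, 0 ≤ a j ⬝ᵥ y := fun j => by rw [← hvec]; exact hy j
      rw [eq_zero_of_forall_dotProduct_nonneg a c hK hx₀ hy', zero_vecMul]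
  refine ⟨μ, hμ, funext fun i => ?_⟩
  have h := congrFun hAμ i
  rw [Pi.zero_apply, mulVec, hA] at h
  rw [Finset.sum_apply, Pi.zero_apply, ← h]
  simp only [Pi.smul_apply, smul_eq_mul, dotProduct, Matrix.of_apply]
  exact sum_congr rfl fun j _ => mul_comm _ _

/-- **Minkowski normalisation of a compact polytope** [cite: Handelman1988, Cor I.2]
[cite: Handelman1988, Prop I.1(c)]: if `K = {x | β_j(x) ≥ 0 ∀ j}` (`β_j = c_j + a_j ⬝ x`, at
least one variable) is compact with non-empty interior, then (Cor I.2) the constant `1` is a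
combination `∑_j μ_j β_j` with all `μ_j > 0` — i.e. `∑ μ_j a_j = 0` and `∑ μ_j c_j = 1` — and
(Prop I.1(c)) every coordinate `x_i` is a linear combination of the `β_j`, i.e. every coordinate
vector is a combination `∑_j γ_j a_j` of the linear parts. ("The principal result in I.1 … goes
back at least to Minkowski.") Proof via `exists_pos_sum_smul_eq_zero` (Stiemke): the constant
`∑ μ_j c_j = ∑ μ_j β_j(x)` is `≥ 0` at a point of `K` and cannot vanish, for then every `β_j`
would vanish on a neighbourhood of an interior point, making every direction a recession
direction; and a linear functional vanishing on all `a_j` is represented by a recession direction,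
hence is zero, so the `a_j` span. -/
theorem exists_pos_sum_smul_affineForm_eq_one [Nonempty ι] [DecidableEq ι] (a : J → ι → ℝ)
    (c : J → ℝ) (hK : IsCompact {x : ι → ℝ | ∀ j, 0 ≤ c j + a j ⬝ᵥ x})
    (hint : (interior {x : ι → ℝ | ∀ j, 0 ≤ c j + a j ⬝ᵥ x}).Nonempty) :
    (∃ μ : J → ℝ, (∀ j, 0 < μ j) ∧ ∑ j, μ j • a j = 0 ∧ ∑ j, μ j * c j = 1) ∧
      ∀ i, ∃ γ : J → ℝ, ∑ j, γ j • a j = Pi.single i 1 := by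
  classical
  set K : Set (ι → ℝ) := {x : ι → ℝ | ∀ j, 0 ≤ c j + a j ⬝ᵥ x} with hKdef
  obtain ⟨x₀, hx₀⟩ := hint
  have hx₀K : x₀ ∈ K := interior_subset hx₀
  have hrec : ∀ y : ι → ℝ, (∀ j, 0 ≤ a j ⬝ᵥ y) → y = 0 :=
    fun y hy => eq_zero_of_forall_dotProduct_nonneg a c hK hx₀K hy
  obtain ⟨μ, hμ, hμa⟩ := exists_pos_sum_smul_eq_zero a c hK ⟨x₀, hx₀K⟩
  -- the constant `κ = ∑ μ_j c_j = ∑ μ_j β_j(x)` (any `x`)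
  set κ : ℝ := ∑ j, μ j * c j with hκ
  have hκx : ∀ x : ι → ℝ, ∑ j, μ j * (c j + a j ⬝ᵥ x) = κ := fun x => by
    have h0 : (∑ j, μ j • a j) ⬝ᵥ x = 0 := by rw [hμa, zero_dotProduct]
    rw [sum_dotProduct] at h0
    simp_rw [smul_dotProduct, smul_eq_mul] at h0
    simp_rw [mul_add]
    rw [sum_add_distrib, h0, add_zero]
  -- `κ > 0`: otherwise all `β_j` vanish near `x₀` and every direction is a recession direction
  have hκpos : 0 < κ := by
    have hterm : ∀ x ∈ K, ∀ j, 0 ≤ μ j * (c j + a j ⬝ᵥ x) :=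
      fun x hx j => mul_nonneg (hμ j).le (hx j)
    have hκ0 : 0 ≤ κ := by rw [← hκx x₀]; exact sum_nonneg fun j _ => hterm x₀ hx₀K j
    rcases hκ0.lt_or_eq with h | h
    · exact h
    exfalso
    -- all `β_j` vanish on `K`
    have hzero : ∀ x ∈ K, ∀ j, c j + a j ⬝ᵥ x = 0 := fun x hx j => by
      have hs : ∑ j, μ j * (c j + a j ⬝ᵥ x) = 0 := by rw [hκx x, ← h]
      have hj := (sum_eq_zero_iff_of_nonneg fun j _ => hterm x hx j).mp hs j (mem_univ j)
      rcases mul_eq_zero.mp hj with h1 | h1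
      · exact absurd h1 (hμ j).ne'
      · exact h1
    -- a ball around `x₀` lies in `K`
    obtain ⟨ε, hε, hball⟩ := Metric.isOpen_iff.mp isOpen_interior x₀ hx₀
    have hdir : ∀ v : ι → ℝ, v = 0 := fun v => by
      set s : ℝ := ε / (2 * (‖v‖ + 1)) with hs
      have hs0 : 0 < s := by positivity
      have hmem : x₀ + s • v ∈ K := by
        refine interior_subset (hball ?_)
        rw [Metric.mem_ball, dist_eq_norm, add_sub_cancel_left, norm_smul, Real.norm_eq_abs,
          abs_of_pos hs0, hs]
        calc ε / (2 * (‖v‖ + 1)) * ‖v‖ ≤ ε / (2 * (‖v‖ + 1)) * (‖v‖ + 1) := by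
              gcongr; linarith
          _ = ε / 2 := by field_simp
          _ < ε := by linarith
      refine hrec v fun j => ?_
      have h1 := hzero _ hmem j
      rw [dotProduct_add, dotProduct_smul, smul_eq_mul, ← add_assoc, hzero x₀ hx₀K j,
        zero_add] at h1
      rcases mul_eq_zero.mp h1 with h2 | h2
      · exact absurd h2 hs0.ne'
      · exact h2.symm.le
    have h1 := congrFun (hdir fun _ => (1 : ℝ)) (Classical.arbitrary ι)
    simp at h1
  refine ⟨⟨fun j => μ j / κ, fun j => div_pos (hμ j) hκpos, ?_, ?_⟩, fun i => ?_⟩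
  · simp_rw [div_eq_inv_mul, mul_smul]
    rw [← Finset.smul_sum, hμa, smul_zero]
  · simp_rw [div_mul_eq_mul_div]
    rw [← Finset.sum_div, ← hκ, div_self hκpos.ne']
  · -- the `a_j` span: a functional vanishing on them is given by a recession direction
    suffices hspan : Submodule.span ℝ (Set.range a) = ⊤ by
      have hi : (Pi.single i 1 : ι → ℝ) ∈ Submodule.span ℝ (Set.range a) := by
        rw [hspan]; exact Submodule.mem_top
      exact (Submodule.mem_span_range_iff_exists_fun ℝ).mp hi
    by_contra hne
    obtain ⟨φ, hφ0, hle⟩ :=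
      Submodule.exists_le_ker_of_lt_top _ (lt_top_iff_ne_top.mpr hne)
    set y : ι → ℝ := fun i => φ fun j => if i = j then 1 else 0 with hy
    have hφ : ∀ v : ι → ℝ, φ v = v ⬝ᵥ y := fun v => by
      rw [LinearMap.pi_apply_eq_sum_univ φ v]
      simp only [smul_eq_mul, dotProduct, hy]
    have hy0 : y = 0 := by
      refine hrec y fun j => ?_
      have hj : φ (a j) = 0 := LinearMap.mem_ker.mp (hle (Submodule.subset_span ⟨j, rfl⟩))
      rw [hφ] at hj
      exact hj.symm.le
    refine hφ0 (LinearMap.ext fun v => ?_)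
    rw [hφ v, hy0, dotProduct_zero, LinearMap.zero_apply]

end Minkowski

section Handelman

variable {ι J : Type*} [Fintype ι] [Fintype J]

/-- **Handelman's theorem (1988), by degree** [cite: Handelman1988, Thm I.3]
[cite: Scheiderer2008, Thm 2.2.5] [cite: PowersReznick2001, §1].
*"Let `β_i = ∑_j a_{ij} x_j + a_{i,d+1}` (`i = 1, …, q`) be linear forms in the `d` variables
`x_j` … Suppose that the convex subset of `ℝ^d` defined by `K = ⋂ β_i⁻¹([0, ∞))` is compact and
has interior. If `f` is a polynomial in `d` variables … such that `f(k) > 0` for all `k` in `K`,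
then `f` may be represented as a positive linear combination of monomials
`β^w = β_1^{w(1)} ⋯ β_q^{w(q)}` in the `β_i`."* (Handelman, Thm I.3, over `L = ℝ`.) In the sharp
form obtained from Pólya's theorem: for every sufficiently large `D` the representation may be
taken over exactly the monomials of total degree `|w| = D`, all with coefficient `> 0`. Here
`d ≥ 1` (`ι` non-empty). Proof: Minkowski normalisation (`exists_pos_sum_smul_affineForm_eq_one`)
and the certificate form `handelman_of_pos_sum_smul_affineForm_eq_one`. -/
theorem handelman_polytope_degree [Nonempty ι] [DecidableEq J] (a : J → ι → ℝ) (c : J → ℝ)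
    (hK : IsCompact {x : ι → ℝ | ∀ j, 0 ≤ c j + a j ⬝ᵥ x})
    (hint : (interior {x : ι → ℝ | ∀ j, 0 ≤ c j + a j ⬝ᵥ x}).Nonempty)
    (p : MvPolynomial ι ℝ) (hpos : ∀ x : ι → ℝ, (∀ j, 0 ≤ c j + a j ⬝ᵥ x) → 0 < eval x p) :
    ∃ D₀ : ℕ, ∀ D : ℕ, D₀ ≤ D → ∃ r : (J →₀ ℕ) → ℝ, (∀ w : J →₀ ℕ, w.degree = D → 0 < r w) ∧
      p = ∑ w ∈ (univ : Finset J).finsuppAntidiag D,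
        C (r w) * ∏ j, affineForm (a j) (c j) ^ w j := by
  classical
  obtain ⟨⟨μ, hμ, hμa, hμc⟩, hspan⟩ := exists_pos_sum_smul_affineForm_eq_one a c hK hint
  exact handelman_of_pos_sum_smul_affineForm_eq_one a c μ hμ hμa hμc hspan p hpos

/-- **Handelman's theorem (1988)** [cite: Handelman1988, Thm I.3] [cite: Scheiderer2008, Thm 2.2.5]:
with `K = {x | β_j(x) ≥ 0 ∀ j} ⊆ ℝ^d` (`d ≥ 1`, `β_j = c_j + a_j ⬝ x` linear) compact with
non-empty interior, every real polynomial `p > 0` on `K` is a positive linear combination of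
monomials in the `β_j`: `p = ∑_{w ∈ s} r_w ∏_j β_j^{w(j)}` for a finite set `s` of exponents and
reals `r_w > 0`. -/
theorem handelman_polytope [Nonempty ι] (a : J → ι → ℝ) (c : J → ℝ)
    (hK : IsCompact {x : ι → ℝ | ∀ j, 0 ≤ c j + a j ⬝ᵥ x})
    (hint : (interior {x : ι → ℝ | ∀ j, 0 ≤ c j + a j ⬝ᵥ x}).Nonempty)
    (p : MvPolynomial ι ℝ) (hpos : ∀ x : ι → ℝ, (∀ j, 0 ≤ c j + a j ⬝ᵥ x) → 0 < eval x p) :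
    ∃ (s : Finset (J →₀ ℕ)) (r : (J →₀ ℕ) → ℝ), (∀ w ∈ s, 0 < r w) ∧
      p = ∑ w ∈ s, C (r w) * ∏ j, affineForm (a j) (c j) ^ w j := by
  classical
  obtain ⟨D₀, hD₀⟩ := handelman_polytope_degree a c hK hint p hpos
  obtain ⟨r, hr, hp⟩ := hD₀ D₀ le_rfl
  refine ⟨_, r, fun w hw => hr w ?_, hp⟩
  rw [mem_finsuppAntidiag] at hw
  rw [Finsupp.degree_eq_sum]; exact hw.1

end Handelman

section AffineFarkas

variable {ι J : Type*} [Fintype ι] [Fintype J]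

/-- **Handelman 1988, Proposition I.1(a)** over `L = ℝ` ("the principal result in I.1 … goes back
at least to Minkowski") [cite: Handelman1988, Prop I.1(a)] [cite: Schrijver1986, Cor 7.1h (p. 93)]:
*"Let `K` be a compact convex polyhedron with interior in `ℝ^d`, defined by `β_i ≥ 0`, where
`β_i = ∑_j a_{ij} x_j + a_{i,d+1}` (`i = 1, …, s`) are linear forms. (a) If `β` is a linear form
and `β | K ≥ 0`, then there exist non-negative `λ_1, λ_2, …, λ_s` … with `β = ∑ λ_i β_i`."*
In coordinates, for `β = d + u ⬝ x`: multipliers `ν_j ≥ 0` with `∑_j ν_j a_j = u` and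
`∑_j ν_j c_j = d` — an identity of affine functions, constants included (the degree-one case of
Handelman's theorem; no strict positivity is needed here). Proof (LP route rather than Handelman's
polarity argument): the affine form of Farkas' lemma (`LPDuality.affine_farkas`, Schrijver
Cor. 7.1h) applied to `K = {x | (−a_j) ⬝ x ≤ c_j}` gives `y ≥ 0` with `∑ y_j a_j = u` and
`∑ y_j c_j ≤ d`; the slack `d − ∑ y_j c_j ≥ 0` times the Minkowski identity `∑ μ_j β_j = 1`
(`exists_pos_sum_smul_affineForm_eq_one`) is added. -/
theorem exists_nonneg_sum_smul_eq_of_nonneg [Nonempty ι] (a : J → ι → ℝ) (c : J → ℝ)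
    (hK : IsCompact {x : ι → ℝ | ∀ j, 0 ≤ c j + a j ⬝ᵥ x})
    (hint : (interior {x : ι → ℝ | ∀ j, 0 ≤ c j + a j ⬝ᵥ x}).Nonempty) (u : ι → ℝ) (d : ℝ)
    (hβ : ∀ x : ι → ℝ, (∀ j, 0 ≤ c j + a j ⬝ᵥ x) → 0 ≤ d + u ⬝ᵥ x) :
    ∃ ν : J → ℝ, (∀ j, 0 ≤ ν j) ∧ ∑ j, ν j • a j = u ∧ ∑ j, ν j * c j = d := by
  classical
  obtain ⟨⟨μ, hμ, hμa, hμc⟩, -⟩ := exists_pos_sum_smul_affineForm_eq_one a c hK hint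
  obtain ⟨x₀, hx₀⟩ := hint
  have hx₀K : ∀ j, 0 ≤ c j + a j ⬝ᵥ x₀ := interior_subset hx₀
  -- `K = {x | A x ≤ c}` for the matrix `A` with rows `−a_j`
  set A : Matrix J ι ℝ := Matrix.of fun j i => -a j i with hA
  have hmul : ∀ (x : ι → ℝ) (j : J), (A *ᵥ x) j = -(a j ⬝ᵥ x) := fun x j => by
    simp only [mulVec, dotProduct, hA, Matrix.of_apply, neg_mul, sum_neg_distrib]
  have hAx : ∀ x : ι → ℝ, A *ᵥ x ≤ c ↔ ∀ j, 0 ≤ c j + a j ⬝ᵥ x := fun x => by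
    rw [Pi.le_def]
    refine forall_congr' fun j => ?_
    rw [hmul]
    constructor <;> intro h <;> linarith
  obtain ⟨y, hy, hyA, hyc⟩ :=
    Literature.Analysis.Convex.LPDuality.affine_farkas A c (-u) (δ := d)
      ⟨x₀, (hAx x₀).mpr hx₀K⟩ fun x hx => by
        have h := hβ x ((hAx x).mp hx)
        rw [neg_dotProduct]
        linarith
  -- `y A = −u` reads `∑ y_j a_j = u`
  have hya : ∑ j, y j • a j = u := by
    funext i
    have h := congrFun hyA i
    simp only [vecMul, dotProduct, hA, Matrix.of_apply, mul_neg, sum_neg_distrib, Pi.neg_apply,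
      neg_inj] at h
    rw [Finset.sum_apply]
    simpa only [Pi.smul_apply, smul_eq_mul] using h
  have he : 0 ≤ d - y ⬝ᵥ c := sub_nonneg.mpr hyc
  refine ⟨fun j => y j + (d - y ⬝ᵥ c) * μ j,
    fun j => add_nonneg (hy j) (mul_nonneg he (hμ j).le), ?_, ?_⟩
  · simp_rw [add_smul, sum_add_distrib, mul_smul, ← Finset.smul_sum, hμa, smul_zero, add_zero]
    exact hya
  · simp_rw [add_mul, sum_add_distrib, mul_assoc, ← Finset.mul_sum, hμc, mul_one]
    rw [show ∑ j, y j * c j = y ⬝ᵥ c from rfl]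
    ring

/-- **Handelman 1988, Proposition I.1(b)** [cite: Handelman1988, Prop I.1(b)]
[cite: Handelman1988, Cor I.2]: *"(b) If the `β` of part (a) is strictly positive as a function
on `K`, then all of the `λ_i` obtained there may be chosen to be strictly greater than zero."*
(Corollary I.2 — `β = 1` — is the case recorded in `exists_pos_sum_smul_affineForm_eq_one`.)
Proof: `β ≥ m > 0` on the compact set `K`; part (a) applied to `β − m`, plus `m ∑_j μ_j β_j = m`
with all `μ_j > 0`. -/
theorem exists_pos_sum_smul_eq_of_pos [Nonempty ι] (a : J → ι → ℝ) (c : J → ℝ)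
    (hK : IsCompact {x : ι → ℝ | ∀ j, 0 ≤ c j + a j ⬝ᵥ x})
    (hint : (interior {x : ι → ℝ | ∀ j, 0 ≤ c j + a j ⬝ᵥ x}).Nonempty) (u : ι → ℝ) (d : ℝ)
    (hβ : ∀ x : ι → ℝ, (∀ j, 0 ≤ c j + a j ⬝ᵥ x) → 0 < d + u ⬝ᵥ x) :
    ∃ ν : J → ℝ, (∀ j, 0 < ν j) ∧ ∑ j, ν j • a j = u ∧ ∑ j, ν j * c j = d := by
  classical
  obtain ⟨⟨μ, hμ, hμa, hμc⟩, -⟩ := exists_pos_sum_smul_affineForm_eq_one a c hK hint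
  obtain ⟨x₀, hx₀⟩ := id hint
  have hx₀K : x₀ ∈ {x : ι → ℝ | ∀ j, 0 ≤ c j + a j ⬝ᵥ x} := interior_subset hx₀
  -- the minimum `m > 0` of `β` on `K`
  have hcont : Continuous fun x : ι → ℝ => d + u ⬝ᵥ x :=
    continuous_const.add (continuous_const.dotProduct continuous_id)
  obtain ⟨x₁, hx₁, hmin⟩ := hK.exists_isMinOn ⟨x₀, hx₀K⟩ hcont.continuousOn
  have hm0 : 0 < d + u ⬝ᵥ x₁ := hβ x₁ hx₁
  obtain ⟨ν, hν, hνa, hνc⟩ :=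
    exists_nonneg_sum_smul_eq_of_nonneg a c hK hint u (d - (d + u ⬝ᵥ x₁)) fun x hx => by
      have h : d + u ⬝ᵥ x₁ ≤ d + u ⬝ᵥ x := isMinOn_iff.mp hmin x hx
      linarith
  refine ⟨fun j => ν j + (d + u ⬝ᵥ x₁) * μ j,
    fun j => add_pos_of_nonneg_of_pos (hν j) (mul_pos hm0 (hμ j)), ?_, ?_⟩
  · simp_rw [add_smul, sum_add_distrib, mul_smul, ← Finset.smul_sum, hμa, smul_zero, add_zero]
    exact hνa
  · simp_rw [add_mul, sum_add_distrib, mul_assoc, ← Finset.mul_sum, hμc, mul_one, hνc]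
    ring

/-- In polynomial terms [cite: Handelman1988, Prop I.1(a)]: multipliers `ν` with `∑_j ν_j a_j = u`
and `∑_j ν_j c_j = d` exhibit the affine polynomial `d + u ⬝ x` as the combination `∑_j ν_j β_j`
of the `β_j = c_j + a_j ⬝ x` in `ℝ[x]` — a degree-one Handelman representation (with
`exists_nonneg_sum_smul_eq_of_nonneg` / `exists_pos_sum_smul_eq_of_pos`: with coefficients `≥ 0`,
resp. `> 0`). -/
theorem affineForm_eq_sum_C_mul_affineForm (a : J → ι → ℝ) (c : J → ℝ) (u : ι → ℝ) (d : ℝ)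
    {ν : J → ℝ} (hνa : ∑ j, ν j • a j = u) (hνc : ∑ j, ν j * c j = d) :
    affineForm u d = ∑ j, C (ν j) * affineForm (a j) (c j) := by
  rw [sum_C_mul_affineForm, hνa, hνc]

end AffineFarkas

section Faces

variable {ι J : Type*} [Fintype ι] [Fintype J]

/-- **Where a Handelman representation can vanish**
[cite: Handelman1988, §III (necessary condition)]:
*"An obvious necessary condition [for `f ∈ R[K]⁺`] is that the restriction of `f` to `K` be
non-negative (as a function); almost as obvious, and following from the definition of `R[K]⁺`, is
that `f⁻¹(0) ∩ K` must be a union of faces."* Precisely: if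
`p = ∑_{w ∈ s} r_w ∏_j β_j^{w(j)}` with all `r_w ≥ 0` vanishes at a point `x₀` with all
`β_j(x₀) ≥ 0`, then `p` vanishes at every point `x` (of `K` or not) at which the linear forms
active at `x₀` vanish: `β_j(x₀) = 0 ⇒ β_j(x) = 0`. (Each term `r_w ∏ β_j(x₀)^{w(j)}` is `≥ 0` and
their sum is `0`, so every term with `r_w > 0` contains an active `β_j` to a positive power.)
Consequently a Handelman (LP) certificate of `p ≥ 0` on `K` can be tight only on a union of faces
of `K`; e.g. it is never tight at a point of the relative interior of a face on which `p` does not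
vanish identically. -/
theorem eval_eq_zero_of_eq_sum_prod_affineForm (a : J → ι → ℝ) (c : J → ℝ)
    (s : Finset (J →₀ ℕ)) (r : (J →₀ ℕ) → ℝ) (hr : ∀ w ∈ s, 0 ≤ r w) (p : MvPolynomial ι ℝ)
    (hp : p = ∑ w ∈ s, C (r w) * ∏ j, affineForm (a j) (c j) ^ w j)
    {x₀ : ι → ℝ} (hx₀ : ∀ j, 0 ≤ c j + a j ⬝ᵥ x₀) (hp₀ : eval x₀ p = 0)
    {x : ι → ℝ} (hx : ∀ j, c j + a j ⬝ᵥ x₀ = 0 → c j + a j ⬝ᵥ x = 0) : eval x p = 0 := by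
  have hterm : ∀ w ∈ s, 0 ≤ r w * ∏ j, (c j + a j ⬝ᵥ x₀) ^ w j :=
    fun w hw => mul_nonneg (hr w hw) (prod_nonneg fun j _ => pow_nonneg (hx₀ j) _)
  have hsum : ∑ w ∈ s, r w * ∏ j, (c j + a j ⬝ᵥ x₀) ^ w j = 0 := by
    rw [hp, map_sum] at hp₀
    simpa only [map_mul, eval_C, map_prod, map_pow, eval_affineForm] using hp₀
  have hzero := (sum_eq_zero_iff_of_nonneg hterm).mp hsum
  rw [hp, map_sum]
  refine sum_eq_zero fun w hw => ?_
  simp only [map_mul, eval_C, map_prod, map_pow, eval_affineForm]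
  rcases mul_eq_zero.mp (hzero w hw) with h | h
  · rw [h, zero_mul]
  · obtain ⟨j, -, hj⟩ := prod_eq_zero_iff.mp h
    obtain ⟨hj0, hwj⟩ : (c j + a j ⬝ᵥ x₀) = 0 ∧ w j ≠ 0 := pow_eq_zero_iff'.mp hj
    exact mul_eq_zero_of_right _
      (prod_eq_zero (mem_univ j) (by rw [hx j hj0]; exact zero_pow hwj))

/-- In particular [cite: Handelman1988, §III (necessary condition)]: a Handelman representation
with coefficients `≥ 0` that vanishes at a point where *all* `β_j > 0` (e.g. an interior point of
`K`) is the zero polynomial — all its coefficients `r_w` (`w ∈ s`) vanish. -/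
theorem coeff_repr_eq_zero_of_eval_eq_zero (a : J → ι → ℝ) (c : J → ℝ)
    (s : Finset (J →₀ ℕ)) (r : (J →₀ ℕ) → ℝ) (hr : ∀ w ∈ s, 0 ≤ r w) (p : MvPolynomial ι ℝ)
    (hp : p = ∑ w ∈ s, C (r w) * ∏ j, affineForm (a j) (c j) ^ w j)
    {x₀ : ι → ℝ} (hx₀ : ∀ j, 0 < c j + a j ⬝ᵥ x₀) (hp₀ : eval x₀ p = 0) :
    (∀ w ∈ s, r w = 0) ∧ p = 0 := by
  have hterm : ∀ w ∈ s, 0 ≤ r w * ∏ j, (c j + a j ⬝ᵥ x₀) ^ w j :=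
    fun w hw => mul_nonneg (hr w hw) (prod_nonneg fun j _ => pow_nonneg (hx₀ j).le _)
  have hsum : ∑ w ∈ s, r w * ∏ j, (c j + a j ⬝ᵥ x₀) ^ w j = 0 := by
    rw [hp, map_sum] at hp₀
    simpa only [map_mul, eval_C, map_prod, map_pow, eval_affineForm] using hp₀
  have hzero := (sum_eq_zero_iff_of_nonneg hterm).mp hsum
  have hr0 : ∀ w ∈ s, r w = 0 := fun w hw => by
    rcases mul_eq_zero.mp (hzero w hw) with h | h
    · exact h
    · exact absurd h (prod_pos fun j _ => pow_pos (hx₀ j) _).ne'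
  refine ⟨hr0, ?_⟩
  rw [hp]
  exact sum_eq_zero fun w hw => by rw [hr0 w hw, C_0, zero_mul]

end Faces

end Literature.Algebra.Polynomial
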